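import Literature.NumberTheory.DiophantineApproximation.DilogLandenLinearIndependence
import Literature.NumberTheory.DiophantineApproximation.DilogLinearIndependence
import Literature.NumberTheory.DiophantineApproximation.NesterenkoCriterion
import Literature.Analysis.SpecialFunctions.DilogarithmLanden
import HarnessLib

/-!
# Viola–Zudilin 2018 — proofs, part I: the reduction to simultaneous approximations

Topic `Literature/NumberTheory/DiophantineApproximation`; pure-proof companion of
`DilogLandenLinearIndependence.lean` (the named fact `ViolaZudilin2018_dilogLandenLinearIndependent`:
`1, Li₁(1/q), Li₂(1/q), Li₂(1/(1−q))` are `ℚ`-linearly independent for every integer `q ≥ 9` or `q ≤ −8`).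
No definitions, no named facts.

Source: C. Viola, W. Zudilin, *Linear independence of dilogarithmic values*, J. reine angew. Math. 736 (2018)
193–223 (= MPIM preprint 2014-26, read in full). The printed proof has two layers:

* (ARITHMETIC–ANALYTIC CORE, §§2–4 and §6.1) for a fixed integer `z ≥ 9`, sequences of linear forms with a
  COMMON integer coefficient `q_n = Δ_n^{-1} d_{Hn} d_{H'n} Q_n(z)`,
  `r_n^{(1)} = q_n Li₁(1/z) − p_n^{(1)}`, `r_n^{(2)} = q_n · ½Li₁(1/z)² − p_n^{(2)}`, `r_n^{(3)} = q_n Li₂(1/z) − p_n^{(3)}`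
  (`p_n^{(μ)} ∈ ℤ`; from the double integrals `J_z^{(1)}`, `K_z`, `J_z`, Lemma 2.1 + Proposition 3.1, the
  permutation group method), with `limsup (1/n) log |r_n^{(3)}| = −(c₀ − c₃)` and
  `limsup (1/n) log |r_n^{(μ)}| ≤ −(c₁ − c₃) < −(c₀ − c₃)` for `μ = 1, 2` (Proposition 4.1, Hata's `ℂ²`-saddle
  method; for `z = 9`: `c₀ = 95.8085…`, `c₁ = 95.8741…`, `c₃ = 93.9698…`, §6.2);
* (REDUCTION, §5.1 and §6.1) the elementary **Lemma 5.1** (common-coefficient criterion: if `r^{(S)}` has exact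
  rate `−τ`, the other `r^{(μ)}` decay faster, and `1, γ₁, …, γ_{S−1}` are `ℚ`-independent, then
  `1, γ₁, …, γ_S` are), applied with `S = 3`, `γ₁ = Li₁(1/z)`, `γ₂ = ½Li₁(1/z)² = −Li₂(1/z) − Li₂(1/(1−z))`
  (**Landen's transformation**), `γ₃ = Li₂(1/z)`, hypothesis (ii) holding because `Li₁(1/z) = log(z/(z−1))` is
  transcendental (Hermite–Lindemann); and `z ≤ −8` is the case `1 − z ≥ 9` since `Li₁(1/(1−z)) = −Li₁(1/z)`.

THIS FILE formalizes the whole REDUCTION layer, following the paper: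
`ViolaZudilin.lemma51` (Lemma 5.1 for `S = 3`, integer coefficients), `ViolaZudilin.intRelation_log_trivial`
(hypothesis (ii): no relation `a + b L + c L²/2 = 0`, `L = Li₁(1/q)`), the Landen and weight-one identities for the
tree's series `DilogPade.polylogSeries` at the levels `q`, `1 − q` (`polylogSeries_two_inv_one_sub`,
`polylogSeries_one_inv_one_sub`), and the assembly
`ViolaZudilin2018_dilogLandenLinearIndependent_of_forms`: **the named fact follows from the existence, for every
integer `q ≥ 9`, of integer sequences `Q_n, P_n^{(1)}, P_n^{(2)}, P_n^{(3)}` with the rates of Proposition 4.1 /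
§6.1** (stated with `ρ₁ < ρ₂`: `|Q_n Li₁ − P^{(1)}_n|, |Q_n ½Li₁² − P^{(2)}_n| ≤ e^{−ρ₂ n}` eventually,
`Q_n Li₂ − P^{(3)}_n → 0` and `≥ e^{−ρ₁ n}` infinitely often — implied by the printed `limsup` conditions).

What is NOT here (part II, the core): the construction of those forms — Lemma 2.1 (via Rhin–Viola 2005,
Thm 2.1), Proposition 3.1 (the permutation group `⟨ν, ϕ⟩`, `Δ_n`), Proposition 4.1 (`ℂ²`-saddle asymptotics) and
the prime number theorem over the set `Ω` of (6.1).

## References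

* C. Viola, W. Zudilin, J. reine angew. Math. 736 (2018) 193–223: Lemma 5.1, §5.1 (choice of `γ₁, γ₂, γ₃`),
  §6.1, Main theorem. [ViolaZudilin2018]
* G. E. Andrews, R. Askey, R. Roy, *Special Functions* (1999), Thm 2.6.1 (Landen). [AndrewsAskeyRoy1999]
-/

noncomputable section

namespace Literature.NumberTheory.DiophantineApproximation

namespace ViolaZudilin

open _root_.Filter _root_.Topology
open DilogPade (polylogSeries)
open Literature.Analysis.SpecialFunctions (realDilog)

/-! ### The series at the two levels `q` and `1 − q` -/

/-- The tree's weight-two series is the series dilogarithm of `Literature/Analysis/SpecialFunctions`: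
`polylogSeries 2 = realDilog` (same `tsum`). [folklore] -/
theorem polylogSeries_two_eq_realDilog (x : ℝ) : polylogSeries 2 x = realDilog x := rfl

/-- `Li₁(x) = Σ_{k≥1} x^k/k = −log(1 − x)` for `|x| < 1` (the logarithmic series). [folklore] -/
theorem polylogSeries_one_eq_neg_log {x : ℝ} (hx : |x| < 1) :
    polylogSeries 1 x = -Real.log (1 - x) := by
  have h := (Real.hasSum_pow_div_log_of_abs_lt_one hx).tsum_eq
  rw [DilogPade.polylogSeries]
  simp only [pow_one]
  exact h

/-- For a real `q` with `|q| > 2`: `|1/q| < 1/2`. [folklore] -/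
theorem abs_inv_lt_half {q : ℝ} (hq : 2 < |q|) : |1 / q| < 1 / 2 := by
  rw [abs_div, abs_one]
  exact one_div_lt_one_div_of_lt two_pos hq

/-- For a real `q` with `|q| > 2`: `|1/(1 − q)| < 1`. [folklore] -/
theorem abs_inv_one_sub_lt_one {q : ℝ} (hq : 2 < |q|) : |1 / (1 - q)| < 1 := by
  have h1 : 1 < |1 - q| := by
    have := abs_sub_abs_le_abs_sub 1 q
    have h' : |q| - |(1 : ℝ)| ≤ |q - 1| := abs_sub_abs_le_abs_sub q 1
    rw [abs_one] at h'
    rw [abs_sub_comm]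
    linarith
  rw [abs_div, abs_one, div_lt_one (lt_trans zero_lt_one h1)]
  exact h1

/-- **Weight one at the two levels**: `Li₁(1/(1−q)) = −Li₁(1/q)` for real `|q| > 2`
(`−log(1 − 1/(1−q)) = −log(q/(q−1)) = log((q−1)/q)`). [cite: ViolaZudilin2018, §1 (Introduction)] -/
theorem polylogSeries_one_inv_one_sub {q : ℝ} (hq : 2 < |q|) :
    polylogSeries 1 (1 / (1 - q)) = -polylogSeries 1 (1 / q) := by
  have hq0 : q ≠ 0 := by rintro rfl; norm_num at hq
  have hq1 : 1 - q ≠ 0 := by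
    intro h
    have : q = 1 := by linarith
    rw [this] at hq; norm_num at hq
  have hq1' : q - 1 ≠ 0 := fun h => hq1 (by linarith)
  rw [polylogSeries_one_eq_neg_log (abs_inv_one_sub_lt_one hq),
    polylogSeries_one_eq_neg_log ((abs_inv_lt_half hq).trans (by norm_num)), neg_neg]
  have e1 : 1 - 1 / (1 - q) = ((q - 1) / q)⁻¹ := by
    rw [inv_div]; field_simp; ring
  have e2 : 1 - 1 / q = (q - 1) / q := by field_simp
  rw [e1, e2, Real.log_inv, neg_neg]

/-- **Landen at the two levels** (Viola–Zudilin, §5.1: `½Li₁(1/z)² = −Li₂(1/z) − Li₂(1/(1−z))`): for real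
`|q| > 2`, `Li₂(1/(1−q)) = −Li₂(1/q) − ½ Li₁(1/q)²`, from Landen's transformation
`Li₂(x) + Li₂(x/(x−1)) = −½ log²(1−x)` (Andrews–Askey–Roy, Thm 2.6.1) at `x = 1/q` and `Li₁(1/q) = −log(1 − 1/q)`.
[cite: ViolaZudilin2018, §5.1] -/
theorem polylogSeries_two_inv_one_sub {q : ℝ} (hq : 2 < |q|) :
    polylogSeries 2 (1 / (1 - q)) = -polylogSeries 2 (1 / q) - (1 / 2) * polylogSeries 1 (1 / q) ^ 2 := by
  have hL := Literature.Analysis.SpecialFunctions.realDilog_inv_add_realDilog_inv_one_sub hq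
  rw [polylogSeries_two_eq_realDilog, polylogSeries_two_eq_realDilog,
    polylogSeries_one_eq_neg_log ((abs_inv_lt_half hq).trans (by norm_num)), neg_sq]
  linarith

/-! ### Lemma 5.1 of Viola–Zudilin (the case `S = 3`) -/

/-- `e^{−ρ n} → 0` for `ρ > 0`. [folklore] -/
theorem tendsto_exp_neg_mul {ρ : ℝ} (hρ : 0 < ρ) :
    Tendsto (fun n : ℕ => Real.exp (-(ρ * n))) atTop (𝓝 0) :=
  Real.tendsto_exp_atBot.comp
    (tendsto_neg_atTop_atBot.comp (tendsto_natCast_atTop_atTop.const_mul_atTop hρ))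

/-- For `ρ₁ < ρ₂` and any constant `K`: eventually `K e^{−ρ₂ n} < e^{−ρ₁ n}`. [folklore] -/
theorem eventually_const_mul_exp_lt {ρ₁ ρ₂ : ℝ} (hρ : ρ₁ < ρ₂) (K : ℝ) :
    ∀ᶠ n : ℕ in atTop, K * Real.exp (-(ρ₂ * n)) < Real.exp (-(ρ₁ * n)) := by
  have h : Tendsto (fun n : ℕ => Real.exp ((ρ₂ - ρ₁) * n)) atTop atTop :=
    Real.tendsto_exp_atTop.comp (tendsto_natCast_atTop_atTop.const_mul_atTop (sub_pos.2 hρ))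
  filter_upwards [h.eventually_gt_atTop K] with n hn
  have hpos : 0 < Real.exp (-(ρ₂ * n)) := Real.exp_pos _
  calc K * Real.exp (-(ρ₂ * n)) < Real.exp ((ρ₂ - ρ₁) * n) * Real.exp (-(ρ₂ * n)) :=
        mul_lt_mul_of_pos_right hn hpos
    _ = Real.exp (-(ρ₁ * n)) := by rw [← Real.exp_add]; ring_nf

/-- **Viola–Zudilin, Lemma 5.1** (the case `S = 3` used in the paper, integer coefficients): let
`γ₁, γ₂, γ₃ ∈ ℝ` and integer sequences `Q_n, P_n^{(1)}, P_n^{(2)}, P_n^{(3)}` give linear forms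
`r_n^{(μ)} = Q_n γ_μ − P_n^{(μ)}` with a COMMON coefficient `Q_n` such that, for some `ρ₁ < ρ₂` (`ρ₂ > 0`),
(i) `|r_n^{(1)}|, |r_n^{(2)}| ≤ e^{−ρ₂ n}` for all large `n`, `r_n^{(3)} → 0` and `|r_n^{(3)}| ≥ e^{−ρ₁ n}` for
infinitely many `n` (this is implied by the printed `limsup (1/n) log|r^{(3)}_n| = −τ`,
`limsup (1/n) log|r^{(μ)}_n| < −τ`), and (ii) `1, γ₁, γ₂` are linearly independent over `ℚ`. Then
`1, γ₁, γ₂, γ₃` are linearly independent over `ℚ`. Proof as printed: a relation `Λ = a + bγ₁ + cγ₂ + dγ₃ = 0`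
gives `0 = Q_nΛ = (aQ_n + bP^{(1)} + cP^{(2)} + dP^{(3)}) + (b r^{(1)} + c r^{(2)} + d r^{(3)})`, the integer
vanishes for large `n`, so `d r^{(3)}_n = −b r^{(1)}_n − c r^{(2)}_n` is `O(e^{−ρ₂ n})`, contradicting
`|r^{(3)}_n| ≥ e^{−ρ₁ n}` infinitely often unless `d = 0`; then (ii). [cite: ViolaZudilin2018, Lemma 5.1] -/
theorem lemma51 {γ₁ γ₂ γ₃ : ℝ} (Q P₁ P₂ P₃ : ℕ → ℤ) {ρ₁ ρ₂ : ℝ} (hρ : ρ₁ < ρ₂) (hρ₂ : 0 < ρ₂)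
    (h₁ : ∀ᶠ n : ℕ in atTop, |Q n * γ₁ - P₁ n| ≤ Real.exp (-(ρ₂ * n)))
    (h₂ : ∀ᶠ n : ℕ in atTop, |Q n * γ₂ - P₂ n| ≤ Real.exp (-(ρ₂ * n)))
    (h₃ : Tendsto (fun n : ℕ => Q n * γ₃ - P₃ n) atTop (𝓝 0))
    (h₃' : ∃ᶠ n : ℕ in atTop, Real.exp (-(ρ₁ * n)) ≤ |Q n * γ₃ - P₃ n|)
    (hind : ∀ a b c : ℤ, (a : ℝ) + b * γ₁ + c * γ₂ = 0 → a = 0 ∧ b = 0 ∧ c = 0)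
    (a b c d : ℤ) (hrel : (a : ℝ) + b * γ₁ + c * γ₂ + d * γ₃ = 0) :
    a = 0 ∧ b = 0 ∧ c = 0 ∧ d = 0 := by
  -- the three remainders and the error combination `E_n = b r₁ + c r₂ + d r₃`
  set r₁ : ℕ → ℝ := fun n => Q n * γ₁ - P₁ n with hr₁
  set r₂ : ℕ → ℝ := fun n => Q n * γ₂ - P₂ n with hr₂
  set r₃ : ℕ → ℝ := fun n => Q n * γ₃ - P₃ n with hr₃
  set E : ℕ → ℝ := fun n => b * r₁ n + c * r₂ n + d * r₃ n with hE
  -- the integer `M_n = a Q_n + b P₁ + c P₂ + d P₃` equals `-E_n` because `Λ = 0`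
  have hM : ∀ n, ((a * Q n + b * P₁ n + c * P₂ n + d * P₃ n : ℤ) : ℝ) = -E n := by
    intro n
    have : (Q n : ℝ) * ((a : ℝ) + b * γ₁ + c * γ₂ + d * γ₃) = 0 := by rw [hrel, mul_zero]
    push_cast
    simp only [hE, hr₁, hr₂, hr₃]
    linear_combination this
  -- `E_n → 0`
  have hexp := tendsto_exp_neg_mul hρ₂
  have ht₁ : Tendsto r₁ atTop (𝓝 0) :=
    squeeze_zero_norm' (by filter_upwards [h₁] with n hn; simpa [Real.norm_eq_abs] using hn) hexp
  have ht₂ : Tendsto r₂ atTop (𝓝 0) :=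
    squeeze_zero_norm' (by filter_upwards [h₂] with n hn; simpa [Real.norm_eq_abs] using hn) hexp
  have htE : Tendsto E atTop (𝓝 0) := by
    have := ((ht₁.const_mul (b : ℝ)).add (ht₂.const_mul (c : ℝ))).add (h₃.const_mul (d : ℝ))
    simpa [hE] using this
  -- hence the integer `M_n` vanishes and `E_n = 0` for all large `n`
  have hE0 : ∀ᶠ n : ℕ in atTop, E n = 0 := by
    filter_upwards [htE.eventually_lt_const zero_lt_one,
      htE.eventually_const_lt (show (-1 : ℝ) < 0 by norm_num)] with n hlt hgt
    have habs : |((a * Q n + b * P₁ n + c * P₂ n + d * P₃ n : ℤ) : ℝ)| < 1 := by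
      rw [hM, abs_neg, abs_lt]; exact ⟨hgt, hlt⟩
    have hint : a * Q n + b * P₁ n + c * P₂ n + d * P₃ n = 0 := by
      rw [← Int.abs_lt_one_iff]; exact_mod_cast habs
    have := hM n
    rw [hint, Int.cast_zero] at this
    linarith
  -- `d = 0`: otherwise `|r₃| ≤ (|b| + |c|) e^{-ρ₂ n}` eventually, against `|r₃| ≥ e^{-ρ₁ n}` frequently
  have hd : d = 0 := by
    by_contra hd
    have hd1 : (1 : ℝ) ≤ |(d : ℝ)| := by exact_mod_cast Int.one_le_abs hd
    apply h₃'
    filter_upwards [hE0, h₁, h₂, eventually_const_mul_exp_lt hρ (|(b : ℝ)| + |(c : ℝ)|)]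
      with n hEn h1n h2n hKn
    rw [not_le]
    have hsum : (d : ℝ) * r₃ n = -((b : ℝ) * r₁ n + c * r₂ n) := by
      simp only [hE] at hEn; linarith
    have hbound : |(d : ℝ)| * |r₃ n| ≤ (|(b : ℝ)| + |(c : ℝ)|) * Real.exp (-(ρ₂ * n)) := by
      rw [← abs_mul, hsum, abs_neg]
      calc |(b : ℝ) * r₁ n + c * r₂ n| ≤ |(b : ℝ) * r₁ n| + |(c : ℝ) * r₂ n| := abs_add_le _ _
        _ = |(b : ℝ)| * |r₁ n| + |(c : ℝ)| * |r₂ n| := by rw [abs_mul, abs_mul]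
        _ ≤ |(b : ℝ)| * Real.exp (-(ρ₂ * n)) + |(c : ℝ)| * Real.exp (-(ρ₂ * n)) :=
            add_le_add (mul_le_mul_of_nonneg_left h1n (abs_nonneg _))
              (mul_le_mul_of_nonneg_left h2n (abs_nonneg _))
        _ = (|(b : ℝ)| + |(c : ℝ)|) * Real.exp (-(ρ₂ * n)) := by ring
    calc |(Q n : ℝ) * γ₃ - P₃ n| = |r₃ n| := rfl
      _ ≤ |(d : ℝ)| * |r₃ n| := le_mul_of_one_le_left (abs_nonneg _) hd1
      _ ≤ (|(b : ℝ)| + |(c : ℝ)|) * Real.exp (-(ρ₂ * n)) := hbound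
      _ < Real.exp (-(ρ₁ * n)) := hKn
  subst hd
  have hrel' : (a : ℝ) + b * γ₁ + c * γ₂ = 0 := by simpa using hrel
  obtain ⟨ha, hb, hc⟩ := hind a b c hrel'
  exact ⟨ha, hb, hc, rfl⟩

/-- From integer to rational coefficients (clearing denominators): if `1, γ₁, γ₂, γ₃` admit no non-trivial
INTEGER relation they admit no non-trivial RATIONAL relation. [folklore] -/
theorem ratRelation_trivial_of_int {γ₁ γ₂ γ₃ : ℝ}
    (H : ∀ a b c d : ℤ, (a : ℝ) + b * γ₁ + c * γ₂ + d * γ₃ = 0 → a = 0 ∧ b = 0 ∧ c = 0 ∧ d = 0)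
    (a b c d : ℚ) (h : (a : ℝ) + b * γ₁ + c * γ₂ + d * γ₃ = 0) :
    a = 0 ∧ b = 0 ∧ c = 0 ∧ d = 0 := by
  obtain ⟨D, hD, m, hm⟩ := NesterenkoCriterion.exists_common_den ![a, b, c, d]
  have hD' : (D : ℝ) ≠ 0 := by exact_mod_cast hD.ne'
  have h0 : (m 0 : ℝ) = a * D := by simpa using hm 0
  have h1 : (m 1 : ℝ) = b * D := by simpa using hm 1
  have h2 : (m 2 : ℝ) = c * D := by simpa using hm 2
  have h3 : (m 3 : ℝ) = d * D := by simpa using hm 3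
  have hrel : (m 0 : ℝ) + m 1 * γ₁ + m 2 * γ₂ + m 3 * γ₃ = 0 := by
    rw [h0, h1, h2, h3]
    linear_combination (D : ℝ) * h
  obtain ⟨e0, e1, e2, e3⟩ := H _ _ _ _ hrel
  have hDq : (D : ℚ) ≠ 0 := by exact_mod_cast hD.ne'
  refine ⟨?_, ?_, ?_, ?_⟩
  · have : (a : ℝ) * D = 0 := by rw [← h0, e0, Int.cast_zero]
    exact_mod_cast (mul_eq_zero.1 this).resolve_right hD'
  · have : (b : ℝ) * D = 0 := by rw [← h1, e1, Int.cast_zero]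
    exact_mod_cast (mul_eq_zero.1 this).resolve_right hD'
  · have : (c : ℝ) * D = 0 := by rw [← h2, e2, Int.cast_zero]
    exact_mod_cast (mul_eq_zero.1 this).resolve_right hD'
  · have : (d : ℝ) * D = 0 := by rw [← h3, e3, Int.cast_zero]
    exact_mod_cast (mul_eq_zero.1 this).resolve_right hD'

/-! ### Hypothesis (ii): `1, Li₁(1/q), ½Li₁(1/q)²` are `ℚ`-independent (Hermite–Lindemann) -/

/-- A transcendental real number satisfies no non-trivial integer relation `a + b L + c L²/2 = 0`
(it would be a root of the non-zero polynomial `a + bX + (c/2)X² ∈ ℚ[X]`). [folklore] -/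
theorem intRelation_sq_trivial_of_transcendental {L : ℝ} (hL : Transcendental ℚ L) (a b c : ℤ)
    (h : (a : ℝ) + b * L + c * (L ^ 2 / 2) = 0) : a = 0 ∧ b = 0 ∧ c = 0 := by
  set p : Polynomial ℚ := Polynomial.C (a : ℚ) + Polynomial.C (b : ℚ) * Polynomial.X +
    Polynomial.C ((c : ℚ) / 2) * Polynomial.X ^ 2 with hp
  have heval : Polynomial.aeval L p = 0 := by
    simp only [hp, map_add, map_mul, Polynomial.aeval_C, Polynomial.aeval_X, map_pow,
      eq_ratCast, Rat.cast_intCast, Rat.cast_div, Rat.cast_ofNat]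
    linear_combination h
  have hp0 : p = 0 := (transcendental_iff.1 hL) p heval
  have c0 := congrArg (fun r : Polynomial ℚ => r.coeff 0) hp0
  have c1 := congrArg (fun r : Polynomial ℚ => r.coeff 1) hp0
  have c2 := congrArg (fun r : Polynomial ℚ => r.coeff 2) hp0
  simp only [hp, Polynomial.coeff_add, Polynomial.coeff_C, Polynomial.coeff_C_mul_X,
    Polynomial.coeff_C_mul_X_pow, Polynomial.coeff_zero] at c0 c1 c2
  norm_num at c0 c1 c2
  exact ⟨by exact_mod_cast c0, by exact_mod_cast c1, by exact_mod_cast c2⟩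

/-- **Hypothesis (ii) of Lemma 5.1 in the application** (Viola–Zudilin, §5.1: "so that condition (ii) is
met"): for an integer `q ≥ 2`, `L = Li₁(1/q) = log(q/(q−1))` is transcendental (Hermite–Lindemann, the tree's
`transcendental_log_ratCast`), hence `1, L, L²/2` satisfy no non-trivial integer relation.
[cite: ViolaZudilin2018, §5.1] -/
theorem intRelation_log_trivial {q : ℕ} (hq : 2 ≤ q) (a b c : ℤ)
    (h : (a : ℝ) + b * polylogSeries 1 (1 / (q : ℝ)) + c * (polylogSeries 1 (1 / (q : ℝ)) ^ 2 / 2) = 0) :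
    a = 0 ∧ b = 0 ∧ c = 0 := by
  refine intRelation_sq_trivial_of_transcendental ?_ a b c h
  rw [DilogPade.polylogSeries_one_eq_log hq]
  have hq' : (2 : ℚ) ≤ q := by exact_mod_cast hq
  have hpos : (0 : ℚ) < (q : ℚ) / ((q : ℚ) - 1) := div_pos (by linarith) (by linarith)
  have hne : (q : ℚ) / ((q : ℚ) - 1) ≠ 1 := by
    rw [Ne, div_eq_one_iff_eq (by linarith)]; linarith
  have ht := Literature.Barriers.KontsevichZagierPeriods.transcendental_log_ratCast _ hpos hne
  have hcast : (((q : ℚ) / ((q : ℚ) - 1) : ℚ) : ℝ) = (q : ℝ) / ((q : ℝ) - 1) := by push_cast; ring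
  rwa [hcast] at ht

/-! ### Assembly: the named fact from the Viola–Zudilin approximating forms -/

/-- **The positive levels** `q ≥ 9` (an integer, as a natural number): given the Viola–Zudilin forms at `q`
(common `Q_n`; `|Q_n Li₁(1/q) − P^{(1)}_n|, |Q_n ½Li₁(1/q)² − P^{(2)}_n| ≤ e^{−ρ₂ n}` eventually;
`Q_n Li₂(1/q) − P^{(3)}_n → 0` and `≥ e^{−ρ₁ n}` infinitely often; `ρ₁ < ρ₂`, `0 < ρ₂`), every rational relation
`a + b Li₁(1/q) + c Li₂(1/q) + d Li₂(1/(1−q)) = 0` is trivial: by Landen it reads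
`a + b γ₁ + (−d) γ₂ + (c − d) γ₃ = 0` with `γ = (Li₁(1/q), ½Li₁(1/q)², Li₂(1/q))`, and Lemma 5.1 applies with
hypothesis (ii) from Hermite–Lindemann. [cite: ViolaZudilin2018, §6.1 (proof of Prop. 6.1)] -/
theorem ratRelation_trivial_of_forms {q : ℕ} (hq : 9 ≤ q) {Q P₁ P₂ P₃ : ℕ → ℤ} {ρ₁ ρ₂ : ℝ}
    (hρ : ρ₁ < ρ₂) (hρ₂ : 0 < ρ₂)
    (h₁ : ∀ᶠ n : ℕ in atTop, |Q n * polylogSeries 1 (1 / (q : ℝ)) - P₁ n| ≤ Real.exp (-(ρ₂ * n)))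
    (h₂ : ∀ᶠ n : ℕ in atTop,
      |Q n * (polylogSeries 1 (1 / (q : ℝ)) ^ 2 / 2) - P₂ n| ≤ Real.exp (-(ρ₂ * n)))
    (h₃ : Tendsto (fun n : ℕ => Q n * polylogSeries 2 (1 / (q : ℝ)) - P₃ n) atTop (𝓝 0))
    (h₃' : ∃ᶠ n : ℕ in atTop, Real.exp (-(ρ₁ * n)) ≤ |Q n * polylogSeries 2 (1 / (q : ℝ)) - P₃ n|)
    (a b c d : ℚ)
    (hrel : (a : ℝ) + b * polylogSeries 1 (1 / (q : ℝ)) + c * polylogSeries 2 (1 / (q : ℝ)) +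
        d * polylogSeries 2 (1 / (1 - (q : ℝ))) = 0) :
    a = 0 ∧ b = 0 ∧ c = 0 ∧ d = 0 := by
  have hq2 : 2 ≤ q := le_trans (by norm_num) hq
  have hqabs : 2 < |(q : ℝ)| := by
    rw [Nat.abs_cast]; exact_mod_cast (show 2 < q by omega)
  set L₁ := polylogSeries 1 (1 / (q : ℝ)) with hL₁
  set L₂ := polylogSeries 2 (1 / (q : ℝ)) with hL₂
  -- Landen: `Li₂(1/(1-q)) = -L₂ - ½ L₁²`
  have hLanden : polylogSeries 2 (1 / (1 - (q : ℝ))) = -L₂ - (1 / 2) * L₁ ^ 2 :=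
    polylogSeries_two_inv_one_sub hqabs
  -- integer relations among `1, L₁, L₁²/2, L₂` are trivial (Lemma 5.1 + Hermite–Lindemann)
  have hint : ∀ a b c d : ℤ, (a : ℝ) + b * L₁ + c * (L₁ ^ 2 / 2) + d * L₂ = 0 →
      a = 0 ∧ b = 0 ∧ c = 0 ∧ d = 0 :=
    lemma51 Q P₁ P₂ P₃ hρ hρ₂ h₁ h₂ h₃ h₃' (intRelation_log_trivial hq2)
  -- the given relation in the coordinates `(1, L₁, L₁²/2, L₂)`: coefficients `(a, b, -d, c - d)`
  have hrel' : (a : ℝ) + b * L₁ + ((-d : ℚ) : ℝ) * (L₁ ^ 2 / 2) + ((c - d : ℚ) : ℝ) * L₂ = 0 := by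
    rw [hLanden] at hrel
    push_cast
    linear_combination hrel
  obtain ⟨ha, hb, hd, hcd⟩ := ratRelation_trivial_of_int hint a b (-d) (c - d) hrel'
  have hd' : d = 0 := neg_eq_zero.1 hd
  refine ⟨ha, hb, ?_, hd'⟩
  rw [hd', sub_zero] at hcd
  exact hcd

/-- **Viola–Zudilin 2018, Main theorem, from the approximating forms** (the complete reduction layer of the
printed proof: Lemma 5.1, Landen, Hermite–Lindemann, and the symmetry `q ↔ 1 − q`): IF for every integer
`q ≥ 9` there are integer sequences `Q_n, P^{(1)}_n, P^{(2)}_n, P^{(3)}_n` and rates `ρ₁ < ρ₂`, `0 < ρ₂`, with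
`|Q_n Li₁(1/q) − P^{(1)}_n| ≤ e^{−ρ₂n}` and `|Q_n ½Li₁(1/q)² − P^{(2)}_n| ≤ e^{−ρ₂n}` for all large `n`,
`Q_n Li₂(1/q) − P^{(3)}_n → 0`, and `|Q_n Li₂(1/q) − P^{(3)}_n| ≥ e^{−ρ₁n}` for infinitely many `n` — which is
what Propositions 3.1 and 4.1 of the paper provide (`ρ₂ ≈ c₁ − c₃ > ρ₁ ≈ c₀ − c₃ > 0`, §6.1–6.2) — THEN the
named fact `ViolaZudilin2018_dilogLandenLinearIndependent` holds (both ranges `q ≥ 9` and `q ≤ −8`, the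
latter being the former at `1 − q` because `Li₁(1/(1−q)) = −Li₁(1/q)`).
[cite: ViolaZudilin2018, Main theorem and §6.1] -/
theorem _root_.Literature.NumberTheory.DiophantineApproximation.ViolaZudilin2018_dilogLandenLinearIndependent_of_forms
    (H : ∀ q : ℕ, 9 ≤ q → ∃ (Q P₁ P₂ P₃ : ℕ → ℤ) (ρ₁ ρ₂ : ℝ), ρ₁ < ρ₂ ∧ 0 < ρ₂ ∧
      (∀ᶠ n : ℕ in atTop, |Q n * polylogSeries 1 (1 / (q : ℝ)) - P₁ n| ≤ Real.exp (-(ρ₂ * n))) ∧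
      (∀ᶠ n : ℕ in atTop,
        |Q n * (polylogSeries 1 (1 / (q : ℝ)) ^ 2 / 2) - P₂ n| ≤ Real.exp (-(ρ₂ * n))) ∧
      Tendsto (fun n : ℕ => Q n * polylogSeries 2 (1 / (q : ℝ)) - P₃ n) atTop (𝓝 0) ∧
      (∃ᶠ n : ℕ in atTop, Real.exp (-(ρ₁ * n)) ≤ |Q n * polylogSeries 2 (1 / (q : ℝ)) - P₃ n|)) :
    ViolaZudilin2018_dilogLandenLinearIndependent := by
  -- the natural-number form of the positive range
  have hpos : ∀ m : ℕ, 9 ≤ m → ∀ a b c d : ℚ,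
      (a : ℝ) + b * polylogSeries 1 (1 / (m : ℝ)) + c * polylogSeries 2 (1 / (m : ℝ)) +
          d * polylogSeries 2 (1 / (1 - (m : ℝ))) = 0 → a = 0 ∧ b = 0 ∧ c = 0 ∧ d = 0 := by
    intro m hm a b c d hrel
    obtain ⟨Q, P₁, P₂, P₃, ρ₁, ρ₂, hρ, hρ₂, h₁, h₂, h₃, h₃'⟩ := H m hm
    exact ratRelation_trivial_of_forms hm hρ hρ₂ h₁ h₂ h₃ h₃' a b c d hrel
  intro q hq a b c d hrel
  rcases hq with hq | hq
  · -- `q ≥ 9`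
    obtain ⟨m, rfl⟩ := Int.eq_ofNat_of_zero_le (by omega : (0 : ℤ) ≤ q)
    have hm : 9 ≤ m := by exact_mod_cast hq
    have hcast : ((m : ℤ) : ℝ) = (m : ℝ) := by norm_cast
    rw [hcast] at hrel
    exact hpos m hm a b c d hrel
  · -- `q ≤ -8`: the levels `1/q = 1/(1-m)` and `1/(1-q) = 1/m` with `m = 1 - q ≥ 9`
    obtain ⟨m, hm⟩ := Int.eq_ofNat_of_zero_le (by omega : (0 : ℤ) ≤ 1 - q)
    have hm9 : 9 ≤ m := by omega
    have hmabs : 2 < |(m : ℝ)| := by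
      rw [Nat.abs_cast]; exact_mod_cast (show 2 < m by omega)
    have hq1 : (q : ℝ) = 1 - (m : ℝ) := by
      have : (q : ℤ) = 1 - (m : ℤ) := by omega
      rw [this]; push_cast; ring
    have hq2 : 1 - (q : ℝ) = (m : ℝ) := by rw [hq1]; ring
    rw [hq2, hq1, polylogSeries_one_inv_one_sub hmabs] at hrel
    have hrel' : (a : ℝ) + ((-b : ℚ) : ℝ) * polylogSeries 1 (1 / (m : ℝ)) +
        d * polylogSeries 2 (1 / (m : ℝ)) + c * polylogSeries 2 (1 / (1 - (m : ℝ))) = 0 := by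
      push_cast
      linear_combination hrel
    obtain ⟨ha, hb, hd, hc⟩ := hpos m hm9 a (-b) d c hrel'
    exact ⟨ha, neg_eq_zero.1 hb, hc, hd⟩

end ViolaZudilin

end Literature.NumberTheory.DiophantineApproximation

end
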